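import Literature.AlgebraicGeometry.HodgeTheory.NonGenericComplexPointsCountable
import Literature.RingTheory.CompleteLocalRings.WittVectorEmbeddingComplex
import Literature.RingTheory.CompleteLocalRings.WittVectorResidueDiscSmooth
import HarnessLib

/-!
# A `p`-adic residue disc of the anchor contains a `W`-point whose complex point is generic

Topic `Literature/AlgebraicGeometry/HodgeTheory` (family `hodge`). Theorems only (no definition, no
named fact). This is the geometric core of the "`p`-adic disc" argument of Maulik–Poonen
(*Néron–Severi groups under specialization*, Duke Math. J. 161 (2012), §4: spread out over a finitely
generated `ℤ`-algebra, embed it into `ℤ_q` (Cassels), and move inside the `q`-adic residue disc of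
the given point to a VERY GENERAL point — possible because the disc is uncountable while only
countably many of its points fail to be very general), in the form used by STUB S
(`ArithmeticDiscSupply`) of the crux line `padic-disc-transport` of
`Summits/HodgeConjecture/HodgeConjecture/Cruxes/VariationalHodge`:

Let `k` be a countable field, `σ : k →+* ℂ`, `S₀` a `k`-scheme whose complexification
`S = S₀ ⊗_σ ℂ` is an affine irreducible curve (locally of finite type, `dim S ≤ 1`), and suppose `S`
is given as the complexification of a SMOOTH AFFINE MODEL `Spec B → Spec R` of relative dimension `1`
over a finitely generated `ℤ`-algebra `R` mapping to `ℂ` by `τ : R →+* ℂ` (a cartesian square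
`S → Spec B` over `Spec ℂ → Spec R`). Then for every complex point `s₀` of `S` and every bound `N`
there are a prime `q ≥ N`, `κ = 𝔽̄_q`, two ring maps `β₀ β : B → W(κ)` agreeing on `R` and with the
SAME REDUCTION `B → κ`, and an embedding `ι : Frac W(κ) → ℂ`, such that `ι ∘ β₀` is the point `s₀`
and `ι ∘ β` is a `k`-GENERIC complex point `s` of `S`
(`exists_wittVector_points_same_reduction_generic`).

Proof: the anchor is a ring map `γ₀ : B → ℂ` over `τ`; its image is a finitely generated subring
`R' ⊆ ℂ`, which embeds into `W(κ)` compatibly with an embedding `ι : Frac W(κ) → ℂ` for all large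
`q` (Cassels, `CompleteLocalRings.exists_injective_ringHom_wittVector_comp_eq`), giving
`β₀ : B → W(κ)`; `W(κ) ⊗_R B` is smooth of relative dimension `1` over `W(κ)`, so the residue disc of
the `W(κ)`-point `β₀` is uncountable (`CompleteLocalRings.not_countable_lifts_wittVector_of_smoothOfRelativeDimension`);
distinct `W(κ)`-points of the disc give distinct complex points of `S` (all over `τ`), and all but
countably many complex points of `S` are `k`-generic
(`HodgeTheory.exists_weilGeneric_of_not_countable_of_complexification`).

* `exists_complexPoint_of_ringHom` — the complex point of `S` attached to a ring map `B → ℂ` over `τ`;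
* `exists_wittVector_points_same_reduction_generic` — the statement above.

## References

* [MaulikPoonen2012] D. Maulik, B. Poonen, Néron–Severi groups under specialization, Duke Math.
  J. 161 (2012), §4 (proof of Thm. 1.1 via `p`-adic discs; the "very general `β ∈ B'(𝒪)`" step).
* [Cassels1976] J. W. S. Cassels, An embedding theorem for fields, Bull. Austral. Math. Soc. 14
  (1976).
* [Hartshorne1977] R. Hartshorne, Algebraic Geometry (1977), II Thm. 3.3.
-/

noncomputable section

open CategoryTheory CategoryTheory.Limits AlgebraicGeometry Cardinal TensorProduct
open _root_.Topology
open Literature.AlgebraicGeometry.Motives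
open Literature.RingTheory.CompleteLocalRings

namespace Literature.AlgebraicGeometry.HodgeTheory

universe u

section Point

variable {L : Type u} [Field L] {S : SchemeOver L} {R B : Type u} [CommRing R] [CommRing B]
  [Algebra R B] (τ : R →+* L) (πS : S.left ⟶ Spec (.of B))
  (hπS : IsPullback πS S.hom (Spec.map (CommRingCat.ofHom (algebraMap R B)))
    (Spec.map (CommRingCat.ofHom τ)))

include hπS

/-- **The `L`-point of `S = Spec B ⊗_{R,τ} L` attached to a ring map `γ : B → L` over `τ`** (universal
property of the fibre product): there is a unique `L`-point `s` of `S` with `s ≫ π = Spec γ`,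
`π : S → Spec B` the projection. [cite: Hartshorne1977, Ch. II Thm. 3.3] -/
theorem exists_algPoint_of_ringHom (γ : B →+* L) (hγ : γ.comp (algebraMap R B) = τ) :
    ∃ s : AlgPoints S L, s.left ≫ πS = Spec.map (CommRingCat.ofHom γ) := by
  have w : Spec.map (CommRingCat.ofHom γ) ≫ Spec.map (CommRingCat.ofHom (algebraMap R B)) =
      𝟙 _ ≫ Spec.map (CommRingCat.ofHom τ) := by
    rw [Category.id_comp, ← Spec.map_comp, ← CommRingCat.ofHom_comp, hγ]
  refine ⟨AlgPoints.mk (hπS.lift (Spec.map (CommRingCat.ofHom γ)) (𝟙 _) w) ?_, ?_⟩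
  · rw [hπS.lift_snd]
    change 𝟙 _ = Spec.map (CommRingCat.ofHom (algebraMap L L))
    rw [Algebra.algebraMap_self, CommRingCat.ofHom_id, Spec.map_id]
  · exact hπS.lift_fst _ _ _

/-- Two `L`-points of `S = Spec B ⊗_{R,τ} L` with the same composite to `Spec B` are equal.
[cite: Hartshorne1977, Ch. II Thm. 3.3] -/
theorem AlgPoints.ext_of_left_comp_eq {s t : AlgPoints S L} (h : s.left ≫ πS = t.left ≫ πS) :
    s = t := by
  ext : 1
  refine hπS.hom_ext h ?_
  rw [Over.w s, Over.w t]

/-- The ring map `B → L` under an `L`-point of `S = Spec B ⊗_{R,τ} L` restricts to `τ` on `R`.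
[cite: Hartshorne1977, Ch. II Thm. 3.3] -/
theorem comp_algebraMap_eq_of_left_comp_eq (s : AlgPoints S L) (γ : B →+* L)
    (h : s.left ≫ πS = Spec.map (CommRingCat.ofHom γ)) : γ.comp (algebraMap R B) = τ := by
  have h1 : (s.left ≫ πS) ≫ Spec.map (CommRingCat.ofHom (algebraMap R B)) =
      Spec.map (CommRingCat.ofHom τ) := by
    rw [Category.assoc, hπS.w, ← Category.assoc, Over.w s]
    change Spec.map (CommRingCat.ofHom (algebraMap L L)) ≫ _ = _
    rw [Algebra.algebraMap_self, CommRingCat.ofHom_id, Spec.map_id, Category.id_comp]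
  rw [h] at h1
  have h2 : Spec.map (CommRingCat.ofHom (algebraMap R B) ≫ CommRingCat.ofHom γ) =
      Spec.map (CommRingCat.ofHom τ) := by
    rw [Spec.map_comp]; exact h1
  rw [← CommRingCat.ofHom_comp] at h2
  have h3 := Spec.map_injective h2
  exact congrArg (fun f : CommRingCat.of R ⟶ CommRingCat.of L => f.hom) h3

end Point

section Disc

variable {k : Type} [Field k] [Countable k] (σ : k →+* ℂ) (S₀ : SchemeOver k)
  [IsAffine ((baseChangeHom σ).obj S₀).left] [IrreducibleSpace ((baseChangeHom σ).obj S₀).left]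
  [LocallyOfFiniteType ((baseChangeHom σ).obj S₀).hom]
  {R B : Type} [CommRing R] [CommRing B] [Algebra R B] [Algebra.FiniteType ℤ R]
  [Algebra.FiniteType R B]
  [SmoothOfRelativeDimension 1 (Spec.map (CommRingCat.ofHom (algebraMap R B)))]
  (τ : R →+* ℂ) (πS : ((baseChangeHom σ).obj S₀).left ⟶ Spec (.of B))
  (hπS : IsPullback πS ((baseChangeHom σ).obj S₀).hom
    (Spec.map (CommRingCat.ofHom (algebraMap R B))) (Spec.map (CommRingCat.ofHom τ)))

include hπS

/-- **A `q`-adic residue disc of the anchor contains a `W`-point whose complex point is `k`-generic**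
(Maulik–Poonen 2012, §4). Let `k` be a countable field, `σ : k →+* ℂ`, `S₀` a `k`-scheme whose
complexification `S = S₀ ⊗_σ ℂ` is affine, irreducible, locally of finite type of dimension `≤ 1`,
given as the base change `S → Spec B` of a smooth affine `R`-curve `Spec B → Spec R` (relative
dimension `1`, `R` and `B` finitely generated) along `τ : R → ℂ`. For every complex point `s₀` of `S`
and every `N` there are a prime `q ≥ N`, `κ = 𝔽̄_q` (algebraically closed, perfect, algebraic over
`𝔽_q`), ring maps `β₀ β : B → W(κ)` and `ι : Frac W(κ) → ℂ`, and a complex point `s` of `S` with: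
`β₀` and `β` agree on `R`; `β₀ ≡ β (mod q)` (same reduction `B → κ`); `ι ∘ β₀` restricted to `R` is
`τ`; `ι ∘ β₀` is the point `s₀` and `ι ∘ β` is the point `s` (as `Spec ℂ → Spec B`); and `s` is
`k`-GENERIC (it lies in no proper subset of `S(ℂ)` defined over `σ(k)`,
`HodgeTheory.IsDefinedOver`). Cassels' embedding of the finitely generated ring `γ₀(B) ⊆ ℂ` of the
anchor, uncountability of the residue disc of the smooth `W(κ)`-curve `W(κ) ⊗_R B`, injectivity of
"`W`-point ↦ complex point", and countability of the non-generic complex points.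
[cite: MaulikPoonen2012, §4 (p-adic disc; very general point of the disc)] -/
theorem exists_wittVector_points_same_reduction_generic
    (hdim : topologicalKrullDim ((baseChangeHom σ).obj S₀).left ≤ 1)
    (s₀ : ComplexPoints ((baseChangeHom σ).obj S₀)) (N : ℕ) :
    ∃ (q : ℕ) (_ : Fact q.Prime) (κ : Type) (_ : Field κ) (_ : CharP κ q) (_ : PerfectRing κ q)
      (_ : IsAlgClosed κ) (_ : Algebra (ZMod q) κ) (_ : Algebra.IsAlgebraic (ZMod q) κ)
      (β₀ β : B →+* WittVector q κ) (ι : FractionRing (WittVector q κ) →+* ℂ)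
      (s : ComplexPoints ((baseChangeHom σ).obj S₀)),
      N ≤ q ∧
      β₀.comp (algebraMap R B) = β.comp (algebraMap R B) ∧
      (WittVector.constantCoeff : WittVector q κ →+* κ).comp β₀ =
        (WittVector.constantCoeff : WittVector q κ →+* κ).comp β ∧
      ((ι.comp (algebraMap (WittVector q κ) (FractionRing (WittVector q κ)))).comp β₀).comp (algebraMap R B) = τ ∧
      s₀.left ≫ πS = Spec.map (CommRingCat.ofHom ((ι.comp (algebraMap (WittVector q κ) (FractionRing (WittVector q κ)))).comp β₀)) ∧
      s.left ≫ πS = Spec.map (CommRingCat.ofHom ((ι.comp (algebraMap (WittVector q κ) (FractionRing (WittVector q κ)))).comp β)) ∧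
      (∀ Z : Set (ComplexPoints ((baseChangeHom σ).obj S₀)),
        IsDefinedOver σ S₀ σ.fieldRange Z → s ∈ Z → Z = Set.univ) := by
  classical
  -- 0. `B` is finitely generated over `ℤ`
  haveI : Algebra.FiniteType ℤ B := by
    letI : Algebra ℤ R := inferInstance
    haveI : IsScalarTower ℤ R B := IsScalarTower.of_algebraMap_eq fun n => by simp
    exact Algebra.FiniteType.trans (S := R) ‹_› ‹_›
  -- 1. the anchor as a ring map `γ₀ : B → ℂ` over `τ`
  obtain ⟨γ₀, hγ₀⟩ : ∃ γ₀ : B →+* ℂ, s₀.left ≫ πS = Spec.map (CommRingCat.ofHom γ₀) := by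
    refine ⟨(Spec.preimage (s₀.left ≫ πS)).hom, ?_⟩
    rw [CommRingCat.ofHom_hom]
    exact (Spec.map_preimage _).symm
  have hγ₀R : γ₀.comp (algebraMap R B) = τ := comp_algebraMap_eq_of_left_comp_eq τ πS hπS s₀ γ₀ hγ₀
  -- 2. the finitely generated subring `R' = γ₀(B) ⊆ ℂ` and Cassels' embedding
  let R' : Subring ℂ := γ₀.range
  haveI : Algebra.FiniteType ℤ R' := by
    have hs : Function.Surjective (γ₀.rangeRestrict.toIntAlgHom : B →ₐ[ℤ] R') :=
      γ₀.rangeRestrict_surjective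
    exact Algebra.FiniteType.of_surjective _ hs
  obtain ⟨N₀, hN₀⟩ :=
    exists_injective_ringHom_wittVector_comp_eq R' R'.subtype Subtype.val_injective
  obtain ⟨q, hqN, hq⟩ := Nat.exists_infinite_primes (max N N₀)
  haveI : Fact q.Prime := ⟨hq⟩
  let κ := AlgebraicClosure (ZMod q)
  haveI : CharP κ q := inferInstance
  have hκ : #κ ≤ 𝔠 :=
    (Algebra.IsAlgebraic.cardinalMk_le_max (ZMod q) κ).trans
      (max_le ((Cardinal.mk_le_aleph0 (α := ZMod q)).trans aleph0_le_continuum)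
        aleph0_le_continuum)
  obtain ⟨φ', ι, -, hι⟩ := hN₀ q ((le_max_right _ _).trans hqN) κ hκ
  haveI : PerfectRing κ q := PerfectField.toPerfectRing q
  set W := WittVector q κ with hW
  -- 3. the `W`-point `β₀` of the anchor, and the structure map `φ : R → W`
  let β₀ : B →+* W := φ'.comp γ₀.rangeRestrict
  have hιβ₀ : (ι.comp (algebraMap W (FractionRing (WittVector q κ)))).comp β₀ = γ₀ := by
    ext b
    exact hι ⟨γ₀ b, ⟨b, rfl⟩⟩
  let φ : R →+* W := β₀.comp (algebraMap R B)
  letI algRW : Algebra R W := φ.toAlgebra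
  have hιφ : ((ι.comp (algebraMap W (FractionRing (WittVector q κ)))).comp β₀).comp (algebraMap R B) = τ := by
    rw [hιβ₀, hγ₀R]
  -- 4. `W ⊗_R B` is smooth of relative dimension `1` over `W`
  have hRB : RingHom.Locally (RingHom.IsStandardSmoothOfRelativeDimension 1) (algebraMap R B) :=
    (HasRingHomProperty.Spec_iff (P := @SmoothOfRelativeDimension 1)).mp ‹_›
  have hWB : RingHom.Locally (RingHom.IsStandardSmoothOfRelativeDimension 1)
      (algebraMap W (W ⊗[R] B)) :=
    (RingHom.locally_isStableUnderBaseChange RingHom.isStandardSmoothOfRelativeDimension_respectsIso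
      (RingHom.isStandardSmoothOfRelativeDimension_isStableUnderBaseChange 1)).tensorProduct W hRB
  haveI : SmoothOfRelativeDimension 1
      (Spec.map (CommRingCat.ofHom (algebraMap W (W ⊗[R] B)))) :=
    (HasRingHomProperty.Spec_iff (P := @SmoothOfRelativeDimension 1)).mpr hWB
  -- 5. the `W`-point `y₀` of `W ⊗_R B` and its reduction `x̄`
  let β₀' : B →ₐ[R] W := { β₀ with commutes' := fun r => rfl }
  let y₀ : W ⊗[R] B →ₐ[W] W := AlgHom.liftEquiv R W B W β₀'
  let xbar : W ⊗[R] B →+* κ := (WittVector.constantCoeff : W →+* κ).comp (y₀ : W ⊗[R] B →+* W)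
  have hx : ∀ w : W, xbar (algebraMap W (W ⊗[R] B) w) = WittVector.constantCoeff w := by
    intro w
    change WittVector.constantCoeff (y₀ (algebraMap W (W ⊗[R] B) w)) = _
    rw [AlgHom.commutes, Algebra.algebraMap_self, RingHom.id_apply]
  -- the residue disc of `y₀` is uncountable
  have hunc := not_countable_lifts_wittVector_of_smoothOfRelativeDimension (p := q) (κ := κ)
    (A := W ⊗[R] B) 1 one_pos xbar hx
  -- 6. the ring maps `B → W` of the points of the disc and their complex points
  let βr : (W ⊗[R] B →ₐ[W] W) → (B →ₐ[R] W) := fun y => (AlgHom.liftEquiv R W B W).symm y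
  have hβr_inj : Function.Injective βr := (AlgHom.liftEquiv R W B W).symm.injective
  have hβr_apply : ∀ y b, βr y b = y (1 ⊗ₜ b) := fun y b => rfl
  let γ : (W ⊗[R] B →ₐ[W] W) → (B →+* ℂ) := fun y =>
    (ι.comp (algebraMap W (FractionRing (WittVector q κ)))).comp (βr y : B →+* W)
  have hγR : ∀ y, (γ y).comp (algebraMap R B) = τ := by
    intro y
    ext r
    change ι (algebraMap W (FractionRing (WittVector q κ)) (βr y (algebraMap R B r))) = τ r
    rw [AlgHom.commutes]
    change ι (algebraMap W (FractionRing (WittVector q κ)) (β₀ (algebraMap R B r))) = τ r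
    exact congrArg (fun f : R →+* ℂ => f r) hιφ
  have hιinj : Function.Injective (ι.comp (algebraMap W (FractionRing (WittVector q κ)))) :=
    ι.injective.comp (IsFractionRing.injective W (FractionRing (WittVector q κ)))
  have hγ_inj : Function.Injective γ := by
    intro y y' h
    apply hβr_inj
    apply AlgHom.coe_ringHom_injective
    refine RingHom.ext fun b => ?_
    exact hιinj (congrArg (fun f : B →+* ℂ => f b) h)
  -- the complex point of `γ y`
  choose pt hpt using fun y => exists_algPoint_of_ringHom τ πS hπS (γ y) (hγR y)
  have hpt_inj : Function.Injective pt := by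
    intro y y' h
    apply hγ_inj
    have h1 : Spec.map (CommRingCat.ofHom (γ y)) = Spec.map (CommRingCat.ofHom (γ y')) := by
      rw [← hpt y, ← hpt y', h]
    exact congrArg (fun f : CommRingCat.of B ⟶ CommRingCat.of ℂ => f.hom) (Spec.map_injective h1)
  -- 7. the image of the disc is uncountable, hence contains a generic point
  set D : Set (W ⊗[R] B →ₐ[W] W) := {y | ∀ a, (y a).coeff 0 = xbar a} with hD
  have hG : ¬ (pt '' D).Countable := by
    intro hc
    apply hunc
    haveI : Countable (pt '' D) := hc.to_subtype
    have hinj : Function.Injective (fun y : D => (⟨pt y.1, Set.mem_image_of_mem pt y.2⟩ : pt '' D)) :=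
      fun y y' h => Subtype.ext (hpt_inj (congrArg Subtype.val h))
    haveI : Countable D := hinj.countable
    exact Set.to_countable D
  obtain ⟨s, ⟨y, hyD, rfl⟩, hgen⟩ :=
    exists_weilGeneric_of_not_countable_of_complexification σ S₀ hdim hG
  -- 8. conclusion
  refine ⟨q, ⟨hq⟩, κ, inferInstance, inferInstance, inferInstance, inferInstance, inferInstance,
    inferInstance, β₀, (βr y : B →+* W), ι, pt y, (le_max_left _ _).trans hqN, ?_, ?_, hιφ,
    ?_, hpt y, hgen⟩
  · -- `β₀` and `β` agree on `R`
    refine RingHom.ext fun r => ?_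
    change φ r = βr y (algebraMap R B r)
    rw [AlgHom.commutes]
    rfl
  · -- same reduction
    refine RingHom.ext fun b => ?_
    change WittVector.constantCoeff (β₀ b) = WittVector.constantCoeff (βr y b)
    rw [hβr_apply]
    have h1 : (y (1 ⊗ₜ b)).coeff 0 = xbar (1 ⊗ₜ b) := hyD _
    have h2 : xbar (1 ⊗ₜ[R] b) = WittVector.constantCoeff (y₀ (1 ⊗ₜ[R] b)) := rfl
    have h3 : y₀ ((1 : W) ⊗ₜ[R] b) = (1 : W) • β₀' b := AlgHom.liftEquiv_tmul _ _ _
    rw [h3, one_smul] at h2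
    change WittVector.constantCoeff (β₀ b) = (y (1 ⊗ₜ b)).coeff 0
    rw [h1, h2]
    rfl
  · -- the anchor
    rw [hγ₀, hιβ₀]

end Disc

end Literature.AlgebraicGeometry.HodgeTheory

end
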